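import Summits.CriticalPhenomena.PercolationContinuityZ3.Theorems.Transplant.SkelNegBParamsFineSize
import Summits.CriticalPhenomena.PercolationContinuityZ3.Theorems.Transplant.SkelNegBChoiceAll
import Summits.CriticalPhenomena.PercolationContinuityZ3.Theorems.Transplant.TwoAxisParaCellsFineFrame
import HarnessLib

/-!
# N1 params, chain of record `NegB`, part S (schedule side): THE LATTICE RECORD `NegB.prF : FinePrm` OF THE CELLS OF RECORD (`⟨800, n_L, h_L, v_L, v_β, 20K·s₀, 20K·s₁, D⟩`,
# `prF.ψ φ′ t = NegB.fine … φ′` by `rfl`), THE CANONICAL REPRESENTATIVE AT A CELL CENTRE IS EXACT (`rep₂ (cen x) = (800(x₀n + x₁v_α), 800(x₀h + x₁v_β))` — `cen x i = c_i·x_i`),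
# and THE LINEAR COLUMN BOUND the (F) schedule binder `hoff` reads: **`NegB.offN x ≤ cOff·‖x‖₁ + 1`** with **`cOff := 800·(ℓ_L + 21·n_L + 1)`**, plus `hoffN` (`‖rep₂ (cen x)‖₁ + 1 ≤ offN x`,
# by `rfl`)

builds on p205010 (kernel theorem, internal audit signed; external expert review pending) — nothing in this file uses p205010; NOTHING is claimed about
the node `SamePDropOfSkeletonNeg₁` (OPEN).
Status sentence (coordinator 2026-08-20T04:30Z): "θ(p_c) = 0 on ℤ^d, all d ≥ 2 — kernel-verified (Lean 4/Mathlib, standard axioms); internal adversarial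
audit SIGNED 2026-08-20 04:29Z; external expert review pending."
Lane `prim-bschramm-*`, seat `prim-bschramm-stmt` (gen 13); helper file (`--supports stmt-CriticalPhenomena-4575 --as helper`); ledger HOME/prim-bschramm-stmt/NEG-PARAMS.md v0.10;
hp-8 g33 2026-08-21T15:4xZ/16:0xZ (the (F) schedule binders `hoff : ∀ x, off x ≤ c·(|x₀|+|x₁|) + 1`, `hoffN : ‖rep₂ pr… (P.cen x)‖₁ + 1 ≤ off x` of `faceOblRM_fineN`, `S.rmax := max P.rmax (c+1)`).
* §1 `TwoAxis.Para.rdiv_mul_left` (`rdiv (d·X) d = X`), **`TwoAxis.Para.rep₂_of_mul`** (`z_i = c_i·v_i ⇒ rep₂ z = (A(v₀n + v₁v_α), A(v₀h + v₁v_β))`), `PCells2.cen_eq_mul` (`cen v i = (20·K·s_i)·v_i`);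
* §2 **`NegB.prF`** (+ `prF_fields`, **`prF_ψ`**: `prF.ψ φ′ t = NegB.fine … φ′`, `prF_c`), **`NegB.cOff`**, `rep₂_cen_at`, `Nrep_cen_le` (`Nrep (cen x) ≤ 800(L̂₁|x₀| + L̂₀|x₁|)`),
  **`offN_le`** (`offN x ≤ cOff·(|x₀|+|x₁|) + 1` under `EqNumL` + `|h_L| ≤ 10 n_L`), **`hoffN_at`**.
[cite: KozmaNitzan2024, §4 pp. 25–26; Lemma 12 (p. 24)] [cite: MartineauTassion2017, §4.3]
-/

noncomputable section

open scoped Classical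

namespace Summit.CriticalPhenomena.PercolationContinuityZ3.Theorems.Transplant

open Literature.Probability.LatticeModels

/-! ## §1 The representative at an exact multiple -/

namespace TwoAxis.Para

/-- `rdiv (d·X) d = X` for `0 < d` (nearest-integer rounding of an exact multiple). [folklore] -/
theorem rdiv_mul_left {d : ℤ} (hd : 0 < d) (X : ℤ) : rdiv (d * X) d = X := by
  unfold rdiv
  have h2d : (0 : ℤ) < 2 * d := by linarith
  have e : 2 * (d * X) + d = d * 1 + (2 * d) * X := by ring
  rw [e, Int.add_mul_ediv_left _ _ h2d.ne']
  have : d * 1 / (2 * d) = 0 := Int.ediv_eq_zero_of_lt (by linarith) (by linarith)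
  rw [this, zero_add]

/-- **The canonical representative of a point whose coordinates are exact multiples of the resolutions**: `z₀ = c₀·v₀`, `z₁ = c₁·v₁` ⇒
`rep₂ z = (A(v₀n + v₁v_α), A(v₀h + v₁v_β))` (no rounding). [this work] -/
theorem rep₂_of_mul {A n h vα vβ c₀ c₁ : ℤ} (hc₀ : 0 < c₀) (hc₁ : 0 < c₁) {z v : Site 2} (hz0 : z 0 = c₀ * v 0) (hz1 : z 1 = c₁ * v 1) :
    rep₂ A n h vα vβ c₀ c₁ z 0 = A * (v 0 * n + v 1 * vα) ∧ rep₂ A n h vα vβ c₀ c₁ z 1 = A * (v 0 * h + v 1 * vβ) := by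
  have hc : 0 < c₀ * c₁ := mul_pos hc₀ hc₁
  unfold rep₂
  simp only [Matrix.cons_val_zero, Matrix.cons_val_one]
  rw [hz0, hz1]
  have e0 : A * (c₀ * v 0 * n * c₁ + c₁ * v 1 * vα * c₀) = c₀ * c₁ * (A * (v 0 * n + v 1 * vα)) := by ring
  have e1 : A * (c₀ * v 0 * h * c₁ + c₁ * v 1 * vβ * c₀) = c₀ * c₁ * (A * (v 0 * h + v 1 * vβ)) := by ring
  rw [e0, e1, rdiv_mul_left hc, rdiv_mul_left hc]
  exact ⟨rfl, rfl⟩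

end TwoAxis.Para

/-- A planar cell centre is the resolution multiple of the cell index: `cen v i = (20·K·s_i)·v_i`. [folklore] -/
theorem PCells2.cen_eq_mul (P : PCells2) (v : Site 2) (i : Fin 2) : P.cen v i = 20 * (P.K : ℤ) * (P.s i : ℤ) * v i := by
  rw [PCells2.cen_apply, PCells2.r_eq]; ring

namespace PlanarSkeletonNeg

namespace NegB

open SkelConc (Consts)
open Neg

section Sched

variable (κ : Consts) {V : Type} [DecidableEq V] [Countable V] {G : SimpleGraph V} [G.LocallyFinite] (Φ : PlanarSkeletonNeg G) (t : V)
  (p : unitInterval) (D : Skelφ.StepI.DataN V) (g f : ℕ)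

/-! ## §2 The lattice record of the cells of record and the linear column bound -/

/-- **THE LATTICE RECORD OF RECORD** `prF := ⟨800, n_L, h_L, v_L, v_β, 20K·s₀, 20K·s₁, D⟩` (hp-8's `FinePrm`; `prF.ψ φ′ t = NegB.fine … φ′`). [this work] -/
def prF : Skelφ.FinePrm where
  A := 800
  n := nL κ Φ t p D g f
  h := hL κ Φ t p D g f
  vα := vL κ Φ t p D g f
  vβ := vβL κ Φ t p D g f
  c₀ := 20 * ((fcells κ Φ t p D g f).K : ℤ) * (((fcells κ Φ t p D g f).s 0 : ℕ) : ℤ)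
  c₁ := 20 * ((fcells κ Φ t p D g f).K : ℤ) * (((fcells κ Φ t p D g f).s 1 : ℕ) : ℤ)
  D := Skelφ.NegPrm.Dof (nL κ Φ t p D g f) (hL κ Φ t p D g f) (ℓL κ Φ t p D g f) (vL κ Φ t p D g f)

/-- The fields of `prF` by `rfl`. [folklore] -/
theorem prF_fields :
    (prF κ Φ t p D g f).A = 800 ∧ (prF κ Φ t p D g f).n = nL κ Φ t p D g f ∧ (prF κ Φ t p D g f).h = hL κ Φ t p D g f ∧
      (prF κ Φ t p D g f).vα = vL κ Φ t p D g f ∧ (prF κ Φ t p D g f).vβ = vβL κ Φ t p D g f ∧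
      (prF κ Φ t p D g f).c₀ = 20 * ((fcells κ Φ t p D g f).K : ℤ) * (((fcells κ Φ t p D g f).s 0 : ℕ) : ℤ) ∧
      (prF κ Φ t p D g f).c₁ = 20 * ((fcells κ Φ t p D g f).K : ℤ) * (((fcells κ Φ t p D g f).s 1 : ℕ) : ℤ) ∧
      (prF κ Φ t p D g f).D = Skelφ.NegPrm.Dof (nL κ Φ t p D g f) (hL κ Φ t p D g f) (ℓL κ Φ t p D g f) (vL κ Φ t p D g f) :=
  ⟨rfl, rfl, rfl, rfl, rfl, rfl, rfl, rfl⟩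

/-- **`prF.ψ φ′ t = NegB.fine … φ′`** (the (F) files' cell map IS the fine window map of record). [folklore] -/
theorem prF_ψ (φ' : V → Site 2) : (prF κ Φ t p D g f).ψ φ' t = fine κ Φ t p D g f φ' := rfl

/-- `prF.D = detD prF.A prF.n prF.h prF.vα prF.vβ` (the determinant slot is the true determinant). [folklore] -/
theorem prF_D : (prF κ Φ t p D g f).D = TwoAxis.Para.detD (prF κ Φ t p D g f).A (prF κ Φ t p D g f).n (prF κ Φ t p D g f).h (prF κ Φ t p D g f).vα (prF κ Φ t p D g f).vβ :=
  rfl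

/-- `0 < prF.c₀`, `0 < prF.c₁`. [folklore] -/
theorem prF_c_pos : 0 < (prF κ Φ t p D g f).c₀ ∧ 0 < (prF κ Φ t p D g f).c₁ := ⟨c_pos κ Φ t p D g f 0, c_pos κ Φ t p D g f 1⟩

/-- **THE COLUMN CONSTANT OF RECORD** `cOff := 800·(ℓ_L + 21·n_L + 1)` (`≥ 800·max(L̂₀, L̂₁)`). [this work] -/
def cOff : ℕ := 800 * (ℓL κ Φ t p D g f + 21 * nL κ Φ t p D g f + 1)

/-- **The representative at a cell centre is exact**: `rep₂ (cen x) = (800(x₀n_L + x₁v_L), 800(x₀h_L + x₁v_β))`. [this work] -/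
theorem rep₂_cen_at (x : Site 2) :
    TwoAxis.Para.rep₂ 800 (nL κ Φ t p D g f) (hL κ Φ t p D g f) (vL κ Φ t p D g f) (vβL κ Φ t p D g f) (prF κ Φ t p D g f).c₀ (prF κ Φ t p D g f).c₁
        ((fcells κ Φ t p D g f).cen x) 0 = 800 * (x 0 * nL κ Φ t p D g f + x 1 * vL κ Φ t p D g f) ∧
      TwoAxis.Para.rep₂ 800 (nL κ Φ t p D g f) (hL κ Φ t p D g f) (vL κ Φ t p D g f) (vβL κ Φ t p D g f) (prF κ Φ t p D g f).c₀ (prF κ Φ t p D g f).c₁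
        ((fcells κ Φ t p D g f).cen x) 1 = 800 * (x 0 * hL κ Φ t p D g f + x 1 * vβL κ Φ t p D g f) :=
  TwoAxis.Para.rep₂_of_mul (prF_c_pos κ Φ t p D g f).1 (prF_c_pos κ Φ t p D g f).2 (PCells2.cen_eq_mul _ x 0) (PCells2.cen_eq_mul _ x 1)

/-- **`Nrep (cen x) ≤ 800·(L̂₁·|x₀| + L̂₀·|x₁|)`** (exact representative + triangle inequality). [this work] -/
theorem Nrep_cen_le (x : Site 2) :
    (Nrep κ Φ t p D g f ((fcells κ Φ t p D g f).cen x) : ℤ) ≤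
      800 * (Skelφ.NegPrm.L1hat (nL κ Φ t p D g f) (hL κ Φ t p D g f) * |x 0| + Skelφ.NegPrm.L0hat (nL κ Φ t p D g f) (hL κ Φ t p D g f) (ℓL κ Φ t p D g f) (vL κ Φ t p D g f) * |x 1|) := by
  obtain ⟨h0, h1⟩ := rep₂_cen_at κ Φ t p D g f x
  unfold Nrep
  push_cast
  rw [show (20 * ((fcells κ Φ t p D g f).K : ℤ) * (((fcells κ Φ t p D g f).s 0 : ℕ) : ℤ)) = (prF κ Φ t p D g f).c₀ from rfl,
    show (20 * ((fcells κ Φ t p D g f).K : ℤ) * (((fcells κ Φ t p D g f).s 1 : ℕ) : ℤ)) = (prF κ Φ t p D g f).c₁ from rfl, h0, h1]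
  unfold Skelφ.NegPrm.L1hat Skelφ.NegPrm.L0hat
  unfold vβL
  have hn : |(nL κ Φ t p D g f : ℤ)| = nL κ Φ t p D g f := abs_of_nonneg (by positivity)
  have e0 : |800 * (x 0 * (nL κ Φ t p D g f : ℤ) + x 1 * vL κ Φ t p D g f)| ≤ 800 * ((nL κ Φ t p D g f : ℤ) * |x 0| + |vL κ Φ t p D g f| * |x 1|) := by
    rw [abs_mul, abs_of_pos (by norm_num : (0 : ℤ) < 800)]
    refine mul_le_mul_of_nonneg_left ?_ (by norm_num)
    calc |x 0 * (nL κ Φ t p D g f : ℤ) + x 1 * vL κ Φ t p D g f| ≤ |x 0 * (nL κ Φ t p D g f : ℤ)| + |x 1 * vL κ Φ t p D g f| := abs_add_le _ _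
      _ = (nL κ Φ t p D g f : ℤ) * |x 0| + |vL κ Φ t p D g f| * |x 1| := by rw [abs_mul, abs_mul, hn]; ring
  have e1 : |800 * (x 0 * hL κ Φ t p D g f + x 1 * Skelφ.NegPrm.vβOf (nL κ Φ t p D g f) (hL κ Φ t p D g f) (ℓL κ Φ t p D g f) (vL κ Φ t p D g f))| ≤
      800 * (|hL κ Φ t p D g f| * |x 0| + |Skelφ.NegPrm.vβOf (nL κ Φ t p D g f) (hL κ Φ t p D g f) (ℓL κ Φ t p D g f) (vL κ Φ t p D g f)| * |x 1|) := by
    rw [abs_mul, abs_of_pos (by norm_num : (0 : ℤ) < 800)]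
    refine mul_le_mul_of_nonneg_left ?_ (by norm_num)
    calc |x 0 * hL κ Φ t p D g f + x 1 * Skelφ.NegPrm.vβOf (nL κ Φ t p D g f) (hL κ Φ t p D g f) (ℓL κ Φ t p D g f) (vL κ Φ t p D g f)|
        ≤ |x 0 * hL κ Φ t p D g f| + |x 1 * Skelφ.NegPrm.vβOf (nL κ Φ t p D g f) (hL κ Φ t p D g f) (ℓL κ Φ t p D g f) (vL κ Φ t p D g f)| := abs_add_le _ _
      _ = |hL κ Φ t p D g f| * |x 0| + |Skelφ.NegPrm.vβOf (nL κ Φ t p D g f) (hL κ Φ t p D g f) (ℓL κ Φ t p D g f) (vL κ Φ t p D g f)| * |x 1| := by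
          rw [abs_mul, abs_mul]; ring
  nlinarith [e0, e1, abs_nonneg (x 0), abs_nonneg (x 1)]

/-- **THE LINEAR COLUMN BOUND (the (F) binder `hoff`)**: `offN x ≤ cOff·(|x₀| + |x₁|) + 1`, under the numeric long clause and `|h_L| ≤ 10·n_L`. [this work] -/
theorem offN_le (hN : EqNumL κ Φ t p D g f) (hκ : (hL κ Φ t p D g f).natAbs ≤ 10 * nL κ Φ t p D g f) (x : Site 2) :
    offN κ Φ t p D g f x ≤ cOff κ Φ t p D g f * ((x 0).natAbs + (x 1).natAbs) + 1 := by
  have h := Nrep_cen_le κ Φ t p D g f x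
  have hL0 := L0hat_le κ Φ t p D g f hN hκ
  have hL1 := L1hat_le κ Φ t p D g f hκ
  have hℓ0 : (0 : ℤ) ≤ ℓL κ Φ t p D g f := by positivity
  have hn0 : (0 : ℤ) ≤ nL κ Φ t p D g f := by positivity
  have hL1' : Skelφ.NegPrm.L1hat (nL κ Φ t p D g f) (hL κ Φ t p D g f) ≤ (ℓL κ Φ t p D g f : ℤ) + 21 * nL κ Φ t p D g f + 1 := by linarith
  have key : (Nrep κ Φ t p D g f ((fcells κ Φ t p D g f).cen x) : ℤ) ≤ 800 * ((ℓL κ Φ t p D g f : ℤ) + 21 * nL κ Φ t p D g f + 1) * (|x 0| + |x 1|) := by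
    nlinarith [h, hL0, hL1', abs_nonneg (x 0), abs_nonneg (x 1)]
  unfold offN cOff
  have : (Nrep κ Φ t p D g f ((fcells κ Φ t p D g f).cen x) : ℤ) ≤ ((800 * (ℓL κ Φ t p D g f + 21 * nL κ Φ t p D g f + 1) * ((x 0).natAbs + (x 1).natAbs) : ℕ) : ℤ) := by
    push_cast; exact key
  have := Int.ofNat_le.1 this
  omega

/-- **The (F) binder `hoffN`**: `‖rep₂ prF… (cen x)‖₁ + 1 ≤ offN x` (by definition of `offN`). [folklore] -/
theorem hoffN_at (x : Site 2) :
    (TwoAxis.Para.rep₂ (prF κ Φ t p D g f).A (prF κ Φ t p D g f).n (prF κ Φ t p D g f).h (prF κ Φ t p D g f).vα (prF κ Φ t p D g f).vβ (prF κ Φ t p D g f).c₀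
          (prF κ Φ t p D g f).c₁ ((fcells κ Φ t p D g f).cen x) 0).natAbs +
        (TwoAxis.Para.rep₂ (prF κ Φ t p D g f).A (prF κ Φ t p D g f).n (prF κ Φ t p D g f).h (prF κ Φ t p D g f).vα (prF κ Φ t p D g f).vβ (prF κ Φ t p D g f).c₀
          (prF κ Φ t p D g f).c₁ ((fcells κ Φ t p D g f).cen x) 1).natAbs + 1 ≤ offN κ Φ t p D g f x :=
  le_rfl

/-- **The (F) binders `hL0/hL1` at the record** (`c₀·L 0 + 2 ≤ D`, `c₁·L 1 + 2 ≤ D` in `FinePrm`'s vocabulary) from `room_fcells_at`. [folklore] -/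
theorem prF_room (hN : EqNumL κ Φ t p D g f) :
    (prF κ Φ t p D g f).c₀ * (prF κ Φ t p D g f).L 0 + 2 ≤ (prF κ Φ t p D g f).D ∧ (prF κ Φ t p D g f).c₁ * (prF κ Φ t p D g f).L 1 + 2 ≤ (prF κ Φ t p D g f).D := by
  obtain ⟨h0, h1⟩ := room_fcells_at κ Φ t p D g f hN
  have e0 : (prF κ Φ t p D g f).L 0 = |(800 : ℤ)| * (|vβL κ Φ t p D g f| + |vL κ Φ t p D g f|) := by
    unfold Skelφ.FinePrm.L Skelφ.FinePrm.lvGen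
    simp only [if_true, Matrix.cons_val_zero, Matrix.cons_val_one]
    rw [add_comm]; rfl
  have e1 : (prF κ Φ t p D g f).L 1 = |(800 : ℤ)| * (|(nL κ Φ t p D g f : ℤ)| + |hL κ Φ t p D g f|) := by
    unfold Skelφ.FinePrm.L Skelφ.FinePrm.lvGen
    simp only [show ((1 : Fin 2) = 0) = False from propext ⟨fun h => absurd h (by decide), False.elim⟩, if_false, Matrix.cons_val_zero, Matrix.cons_val_one]
    rfl
  rw [e0, e1]
  exact ⟨h0, h1⟩

end Sched

end NegB

end PlanarSkeletonNeg

end Summit.CriticalPhenomena.PercolationContinuityZ3.Theorems.Transplant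

end
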